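import Mathlib.NumberTheory.LegendreSymbol.JacobiSymbol
import Mathlib.Data.Nat.Squarefree
import Mathlib.Data.Nat.PrimeFin
import HarnessLib

set_option linter.dupNamespace false -- `…BirchSwinnertonDyer.BirchSwinnertonDyer…` is the cell's namespace (D-0017)
set_option autoImplicit false

/-!
# Twin″ (item 19140) — line «heegner-halves» v2: the NUMBER-THEORETIC CORE of the parity law P1 on the
# additive `ℚ(√−7)` cell — the inert-prime count `ι` is ADDITIVE over the twin pair and ODD on a Heegner
# discriminant, by quadratic reciprocity

Leafhand `leafhand-bsd-goldfeldalltwistst-3-g0` (prover, explicit unit, 2026-08-31), `--supports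
stmt-BirchSwinnertonDyer-19140` (crux twin″ `BSDTwoCMSevenAdditiveRankOne`, registered skeleton
`5ff791a1e67d6e63` = `Cruxes/BSDTwoCMSevenAdditiveRankOne/Lines/heegner_halves_v2.lean`). Theses-free; theorems
only; no `sorry`, no definition, no named fact, no instance, no notation. HONEST FRAMING: elementary
arithmetic of Jacobi symbols; it closes NO stub of the line (both `2`-adic halves stay research-open, the
print bundle stays Literature debt); BSD is proved for no curve.

WHY (diagnosis → next variant). The two active halves `stub_heegnerIndexUpperAtTwo` / `stub_heegnerIndexLowerAtTwo`
assert `ord₂ #Ш(W) ≤ ord₂ 𝔮` / `ord₂ 𝔮 ≤ ord₂ #Ш(W)` for the `L`-free index quotient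
`𝔮 = 8·I²·t_W² / (n·k²·t_K²·c²·w²·q(Wd)·|u|·c_W)` (`P2.cmHeegnerIndexQuotient`), `q(Wd) = #Ш(Wd)·c(Wd)/#Wd(ℚ)²`.
Neither is in print at additive `2` (Li–Tian–Yan–Zhu 2025 §1.3 (II)). Their MOD-2 SHADOW — the typed parity law
P1 `P2.CMRankOneHeegnerIndexParityAtTwo` («`ord₂ 𝔮` is even», a consequence of the crux by Cassels–Tate,
`P2.cmRankOneHeegnerIndexParityAtTwo_of_input`) — IS accessible on this cell: every squared factor of `𝔮` has
even valuation, `#Ш(Wd)` is a square (Cassels–Tate), `n = 1` (`Δ < 0`), and by seat c301's uniform Tamagawa law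
(`GoldfeldGoodTwists.tamagawaProduct_cellTwist_eq_two_pow`: `ord₂ ∏_p c_p(49a1^{(d)}) = 3 + ι(d) + 2σ(d)`, `ι(d)` =
number of odd prime factors of `d` inert in `ℚ(√−7)`) the only odd-looking unit left in `ord₂ 𝔮` is
`3 + (3 + ι(d)) + (3 + ι(d·d_K)) + ord₂|u|`, the twin `W^{(d_K)}` being the cell twist of parameter `d·d_K`
(`gcd(d, d_K) = 1` by the Heegner hypothesis). THIS FILE proves the two arithmetic facts that make that unit
EVEN (granted `ord₂|u|` even):
* `card_inertSeven_primeFactors_mul` — **`ι(d·m) = ι(d) + ι(m)`** for coprime non-zero `d`, `m` (so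
  `ι(d) + ι(d·d_K) ≡ ι(d_K) (mod 2)`);
* `odd_card_inertSeven_primeFactors_of_jacobiSym_eq_neg_one` — **`(m/7) = −1 ⟹ ι(m)` is ODD** for squarefree `m`
  (multiplicativity of the Jacobi symbol over the prime factorisation), and its Heegner-field instance
  `odd_card_inertSeven_primeFactors_natAbs_of_heegnerDiscr` — for a NEGATIVE `D` with `|D|` squarefree and `7` split in
  `ℚ(√D)` (`(D/7) = 1`, forced by the Heegner hypothesis at the level `7² ∣ N`), **`ι(|D|)` is odd** (as
  `(−1/7) = −1`); hence `odd_card_inertSeven_add_of_heegnerDiscr`: **`ι(d) + ι(d·|D|)` is odd**.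
The remaining (model-side) steps of P1 on the cell are listed in the hand's census (n = 1; `|Cd.u| = 1` between
minimal models; `Wd` in cell currency with parameter `d·d_K`; Cassels–Tate for `Ш(Wd)`; the squared factors are
non-zero by `GoldfeldGoodTwists.heegnerDatum_nondegenerate_of_facts`).

References: [Silverman1994] IV.9 Table 4.1 (type `I₀*`: `c_ℓ = 1 + #{roots}`); [IrelandRosen1990] Prop. 5.2.2,
Thm. 5.2.1 (Jacobi reciprocity); [Cassels1962ArithmeticIV] (squareness of `#Ш`); [Miller2011LMS] Def. 1.1;
[LiTianYanZhu2025] §1.3 (II).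
-/

namespace Summit.BirchSwinnertonDyer.BirchSwinnertonDyer.Theorems.GoldfeldGoodTwists

open Finset

section JacobiProducts

/-- **The Jacobi symbol is multiplicative in its top argument over a `Finset` product** (of natural numbers
cast to `ℤ`): `J(∏_{l ∈ s} l | b) = ∏_{l ∈ s} J(l | b)`. [folklore] -/
theorem jacobiSym_finsetProd_natCast_left (s : Finset ℕ) (b : ℕ) :
    jacobiSym (∏ l ∈ s, (l : ℤ)) b = ∏ l ∈ s, jacobiSym l b := by
  classical
  induction s using Finset.induction_on with
  | empty => simp [jacobiSym.one_left]
  | insert a s ha ih => rw [Finset.prod_insert ha, Finset.prod_insert ha, jacobiSym.mul_left, ih]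

/-- **`J(m | b) = ∏_{l ∣ m prime} J(l | b)` for SQUAREFREE `m`** (the prime factorisation of a squarefree number
is the product of its prime factors, `Nat.prod_primeFactors_of_squarefree`). [folklore] -/
theorem jacobiSym_eq_prod_primeFactors_of_squarefree {m : ℕ} (hm : Squarefree m) (b : ℕ) :
    jacobiSym m b = ∏ l ∈ m.primeFactors, jacobiSym l b := by
  rw [← jacobiSym_finsetProd_natCast_left, ← Nat.cast_prod, Nat.prod_primeFactors_of_squarefree hm]

/-- **A product of signs is `(−1)^(number of minus signs)`**: if every `J(l | 7)`, `l ∈ s`, is `±1`, then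
`∏_{l ∈ s} J(l | 7) = (−1)^{#{l ∈ s : J(l | 7) = −1}}`. [folklore] -/
theorem prod_jacobiSym_seven_eq_neg_one_pow_card (s : Finset ℕ)
    (hs : ∀ l ∈ s, jacobiSym l 7 = 1 ∨ jacobiSym l 7 = -1) :
    ∏ l ∈ s, jacobiSym l 7 = (-1) ^ (s.filter (fun l : ℕ => jacobiSym l 7 = -1)).card := by
  classical
  rw [← Finset.prod_filter_mul_prod_filter_not s (fun l : ℕ => jacobiSym l 7 = -1)]
  have h1 : ∏ l ∈ s.filter (fun l : ℕ => jacobiSym l 7 = -1), jacobiSym l 7 =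
      (-1) ^ (s.filter (fun l : ℕ => jacobiSym l 7 = -1)).card := by
    rw [← Finset.prod_const]
    exact Finset.prod_congr rfl fun l hl => (Finset.mem_filter.mp hl).2
  have h2 : ∏ l ∈ s.filter (fun l : ℕ => ¬ jacobiSym l 7 = -1), jacobiSym l 7 = 1 :=
    Finset.prod_eq_one fun l hl => by
      obtain ⟨hls, hne⟩ := Finset.mem_filter.mp hl
      exact (hs l hls).resolve_right hne
  rw [h1, h2, mul_one]

/-- **A prime factor `l` of an `m` with `J(m | 7) ≠ 0` has `J(l | 7) = ±1`** (`7 ∤ m`, so `gcd(l, 7) = 1`). [folklore] -/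
theorem jacobiSym_seven_eq_one_or_eq_neg_one_of_mem_primeFactors {m l : ℕ} (hm : jacobiSym m 7 ≠ 0)
    (hl : l ∈ m.primeFactors) : jacobiSym l 7 = 1 ∨ jacobiSym l 7 = -1 := by
  refine jacobiSym.eq_one_or_neg_one ?_
  -- `gcd(l, 7) = 1`: otherwise `7 ∣ l ∣ m` and `J(m | 7) = 0`
  have h7m : ¬ (7 : ℕ) ∣ m := by
    intro h
    apply hm
    rw [jacobiSym.eq_zero_iff]
    refine ⟨by norm_num, ?_⟩
    rw [Int.gcd_natCast_natCast]
    intro hg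
    have : (7 : ℕ) ∣ Nat.gcd m 7 := Nat.dvd_gcd h (dvd_refl 7)
    rw [hg] at this
    norm_num at this
  have hlp : l.Prime := Nat.prime_of_mem_primeFactors hl
  have hlm : l ∣ m := Nat.dvd_of_mem_primeFactors hl
  rw [Int.gcd_natCast_natCast]
  have h7 : Nat.Prime 7 := by decide
  rcases (Nat.coprime_primes hlp h7).mpr (fun h => h7m (h ▸ hlm)) with hc
  exact hc

/-- **`(m/7) = −1 ⟹ ι(m)` is ODD** (`m` squarefree): the number of prime factors `l` of `m` with `(l/7) = −1`
— the primes INERT in `ℚ(√−7)`, as `(−7/l) = (l/7)` for odd `l` (`GoldfeldGoodTwists.jacobiSym_neg_seven_eq_of_odd`)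
and `2` is split — is odd. Proof: `−1 = J(m | 7) = ∏_l J(l | 7) = (−1)^{ι(m)}`. [folklore] -/
theorem odd_card_inertSeven_primeFactors_of_jacobiSym_eq_neg_one {m : ℕ} (hm : Squarefree m)
    (hJ : jacobiSym m 7 = -1) :
    Odd (m.primeFactors.filter (fun l : ℕ => jacobiSym l 7 = -1)).card := by
  have hprod := jacobiSym_eq_prod_primeFactors_of_squarefree hm 7
  rw [hJ, prod_jacobiSym_seven_eq_neg_one_pow_card _ (fun l hl =>
    jacobiSym_seven_eq_one_or_eq_neg_one_of_mem_primeFactors (by rw [hJ]; norm_num) hl)] at hprod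
  by_contra hodd
  rw [Nat.not_odd_iff_even] at hodd
  rw [hodd.neg_one_pow] at hprod
  norm_num at hprod

/-- **The `erase 2` in the cell's `ι` is harmless**: `2` is split in `ℚ(√−7)` (`J(2 | 7) = 1`), so removing it does
not change the inert count — `#{l ∈ s.erase 2 : J(l|7) = −1} = #{l ∈ s : J(l|7) = −1}` (the cell's Tamagawa law
`tamagawaProduct_cellTwist_eq_two_pow` is written with `(d.natAbs.primeFactors.erase 2).filter …`). [folklore] -/
theorem card_filter_erase_two_eq (s : Finset ℕ) :
    ((s.erase 2).filter (fun l : ℕ => jacobiSym l 7 = -1)).card =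
      (s.filter (fun l : ℕ => jacobiSym l 7 = -1)).card := by
  rw [Finset.filter_erase, Finset.erase_eq_of_notMem]
  intro h
  have h2 : jacobiSym (2 : ℕ) 7 = -1 := (Finset.mem_filter.mp h).2
  have : jacobiSym ((2 : ℕ) : ℤ) 7 = 1 := by
    rw [Nat.cast_ofNat, jacobiSym.at_two (by decide), ZMod.χ₈_nat_eq_if_mod_eight]; norm_num
  rw [this] at h2
  norm_num at h2

end JacobiProducts

section TwinPair

/-- **`ι` IS ADDITIVE OVER THE TWIN PAIR: `ι(d·m) = ι(d) + ι(m)`** for coprime non-zero `d`, `m` — the prime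
factors of `d·m` are the disjoint union of those of `d` and of `m`. On the cell: the rank-zero twin `W^{(d_K)}` of
`W = 49a1^{(d)}` is `49a1^{(d·d_K)}` with `gcd(d, d_K) = 1` (every prime of the level splits in `K`).
[cite: Silverman1994, IV.9 Table 4.1] -/
theorem card_inertSeven_primeFactors_mul {d m : ℕ} (hd : d ≠ 0) (hm : m ≠ 0) (hdm : Nat.Coprime d m) :
    (((d * m).primeFactors.erase 2).filter (fun l : ℕ => jacobiSym l 7 = -1)).card =
      ((d.primeFactors.erase 2).filter (fun l : ℕ => jacobiSym l 7 = -1)).card +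
        ((m.primeFactors.erase 2).filter (fun l : ℕ => jacobiSym l 7 = -1)).card := by
  rw [Nat.primeFactors_mul hd hm, Finset.erase_union_distrib, Finset.filter_union,
    Finset.card_union_of_disjoint]
  exact Finset.disjoint_filter_filter
    (hdm.disjoint_primeFactors.mono (Finset.erase_subset _ _) (Finset.erase_subset _ _))

/-- **A HEEGNER DISCRIMINANT FOR THE CELL HAS AN ODD NUMBER OF `ℚ(√−7)`-INERT PRIME FACTORS.** If `D < 0`,
`|D|` is squarefree and `7` splits in `ℚ(√D)` — `(D/7) = 1`, forced by the Heegner hypothesis since `7² ∣ N` for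
every curve of the cell — then `ι(|D|)` is odd: `(|D|/7) = (−1/7)·(D/7)·… = −(D/7) = −1` (`|D| = −D`,
`(−1/7) = −1` as `7 ≡ 3 (mod 4)`), then `odd_card_inertSeven_primeFactors_of_jacobiSym_eq_neg_one`. For the odd
fundamental discriminants `d_K ≡ 1 (mod 8)` of the line's Heegner fields `|d_K|` is squarefree.
[cite: IrelandRosen1990, Prop. 5.2.2] -/
theorem odd_card_inertSeven_primeFactors_natAbs_of_heegnerDiscr {D : ℤ} (hD : D < 0)
    (hsq : Squarefree D.natAbs) (h7 : jacobiSym D 7 = 1) :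
    Odd ((D.natAbs.primeFactors.erase 2).filter (fun l : ℕ => jacobiSym l 7 = -1)).card := by
  rw [card_filter_erase_two_eq]
  refine odd_card_inertSeven_primeFactors_of_jacobiSym_eq_neg_one hsq ?_
  -- `(|D| / 7) = (−D / 7) = χ₄(7)·(D/7) = −1`
  have hnat : ((D.natAbs : ℕ) : ℤ) = -D := by
    rw [Int.natCast_natAbs, abs_of_neg hD]
  rw [hnat, jacobiSym.neg _ (by decide : Odd 7), h7, mul_one, ZMod.χ₄_nat_three_mod_four (by decide)]

/-- **THE PARITY UNIT OF P1 ON THE CELL: `ι(d) + ι(d·|D|)` IS ODD** for `d ≠ 0` coprime to the Heegner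
discriminant `D` (`D < 0`, `|D|` squarefree, `(D/7) = 1`): by additivity it is `2·ι(d) + ι(|D|)` with `ι(|D|)`
odd. With seat c301's `tamagawaProduct_cellTwist_eq_two_pow` for `W = 49a1^{(d)}` and for its twin
`W^{(D)} = 49a1^{(d·D)}` this is «`ord₂ ∏c_p(W) + ord₂ ∏c_p(W^{(D)}) = 6 + ι(d) + ι(d·|D|) + 2(σ + σ′)` is ODD» — the
unit that, together with the factor `8`, makes `ord₂ 𝔮` even (P1) once `ord₂ |u|` is even.
[cite: Silverman1994, IV.9 Table 4.1] [cite: IrelandRosen1990, Prop. 5.2.2] -/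
theorem odd_card_inertSeven_add_of_heegnerDiscr {d : ℕ} (hd : d ≠ 0) {D : ℤ} (hD : D < 0)
    (hsq : Squarefree D.natAbs) (h7 : jacobiSym D 7 = 1) (hcop : Nat.Coprime d D.natAbs) :
    Odd (((d.primeFactors.erase 2).filter (fun l : ℕ => jacobiSym l 7 = -1)).card +
      (((d * D.natAbs).primeFactors.erase 2).filter (fun l : ℕ => jacobiSym l 7 = -1)).card) := by
  have hD0 : D.natAbs ≠ 0 := Int.natAbs_ne_zero.mpr hD.ne
  rw [card_inertSeven_primeFactors_mul hd hD0 hcop, ← add_assoc, ← two_mul]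
  exact Even.add_odd (even_two_mul _) (odd_card_inertSeven_primeFactors_natAbs_of_heegnerDiscr hD hsq h7)

/-- **The same in the tree's `ℤ`-currency** (the cell's `ι(d)` is written on `d.natAbs` for a twist parameter
`d : ℤ`, `GoldfeldGoodTwists.tamagawaProduct_cellTwist_eq_two_pow`): for `d ≠ 0` and a Heegner discriminant `D`
(`D < 0`, `|D|` squarefree, `(D/7) = 1`) with `gcd(d, D) = 1`, **`ι(d) + ι(d·D)` is odd** — `d·D` being the twist
parameter of the rank-zero twin `W^{(D)} = 49a1^{(d·D)}` of `W = 49a1^{(d)}` (`d·D ≡ d (mod 4)` as `D ≡ 1 (mod 8)`,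
so the twin lies in the same cell family). [cite: Silverman1994, IV.9 Table 4.1] [cite: IrelandRosen1990, Prop. 5.2.2] -/
theorem odd_card_inertSeven_add_mul_of_heegnerDiscr {d D : ℤ} (hd : d ≠ 0) (hD : D < 0)
    (hsq : Squarefree D.natAbs) (h7 : jacobiSym D 7 = 1) (hcop : Int.gcd d D = 1) :
    Odd (((d.natAbs.primeFactors.erase 2).filter (fun l : ℕ => jacobiSym l 7 = -1)).card +
      (((d * D).natAbs.primeFactors.erase 2).filter (fun l : ℕ => jacobiSym l 7 = -1)).card) := by
  rw [Int.natAbs_mul]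
  have hcop' : Nat.Coprime d.natAbs D.natAbs := by rw [Nat.Coprime, ← Int.gcd_eq_natAbs]; exact hcop
  exact odd_card_inertSeven_add_of_heegnerDiscr (Int.natAbs_ne_zero.mpr hd) hD hsq h7 hcop'

end TwinPair

end Summit.BirchSwinnertonDyer.BirchSwinnertonDyer.Theorems.GoldfeldGoodTwists
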